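import Mathlib
import Summits.NavierStokesRegularity.NavierStokesRegularity.Theorems.EulerZoomLiouvillePowerGaugeEulerLiouvilleSelfSimilarKelvinFlow
import Literature.Analysis.FluidPDE.SelfSimilarEulerTrappedTrajectories
import HarnessLib

/-!
# Rung C1 of the crux `EulerZoomLiouville.PowerGaugeEulerLiouville`: in the window, EVERY point of space
# flows backward into the stagnation set of the self-similar Lagrangian flow
# (route №10, item stmt-NavierStokesRegularity-19832; `--supports`)

Helper file (theorems only). Seat ns-typeII-p3 (cell ns-regularity-ideate §B, D-0081).  Rung C1 (exactly
self-similar members), the lead's open stub `stub_selfSimilarExtremal` (the Chae–Shvydkoy window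
`0 < ρ ≤ 1/2`, `γ = 1/(2+ρ) ∈ [2/5, ½)`).  PROFILE-LEVEL structural statement for a classical stationary profile
`(V, P)` (`IsSelfSimilarEulerProfile γ 0 V P`, CIV 2026 (3.3)) with `V` smooth, bounded, of bounded gradient and
`P` bounded above (all implied by the far field (3.8)); `Φ_s` is the self-similar Lagrangian flow of
`W = γy + V` (lead's `…SelfSimilarKelvinFlow`):

* `bernoulli_le_quadratic` / `norm_le_of_bernoulli_ge` — for `0 < γ < ½` the self-similar Bernoulli
  function `ℋ = ½|W|² + P + ½γ(γ−1)|y|²` (CIV (3.30)) tends to `−∞` at infinity: its superlevel sets are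
  bounded (`ℋ(z) ≥ h₀ ⇒ ‖z‖ ≤ B(h₀)`);
* `norm_flow_le_of_nonpos` — **backward trajectories are bounded**: `ℋ` is non-increasing forward along the
  flow (`dℋ/ds = (2γ−1)|W|² ≤ 0`, CIV (3.31)), so `Φ_s y`, `s ≤ 0`, stays in `{ℋ ≥ ℋ(y)}`;
* `tendsto_transport_flow_atBot` — **`W(Φ_s y) → 0` as `s → −∞` for EVERY `y`** (the tree's Barbalat
  argument `IsSelfSimilarEulerProfile.tendsto_transport_comp_of_bounded` with `σ = −1`);
* `exists_mem_nodalSet_mapClusterPt_atBot` — hence every point's backward trajectory ACCUMULATES AT A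
  STAGNATION POINT `z ∈ 𝒩_W` with `ℋ(z) ≥ ℋ(y)`: in similarity variables every fluid particle of an in-window
  profile EMANATES from the stagnation set — the unstable set of `𝒩_W` is all of `ℝ³`.  Portrait / kill-test
  reading for candidate refuting profiles: `𝒩_W ≠ ∅`, and the candidate's stagnation points must feed every
  region of space backward in time (CIV Rem. 3.6 names the fixed points and their invariant manifolds as the
  organising objects; this makes the statement global and symmetry-free).

WHAT THIS IS NOT: not NS, not E, not rung C1 — Lagrangian structure of CLASSICAL in-window profiles; it
constrains candidates, it excludes nothing by itself.  [folklore; cf. ConstantinIgnatovaVicol2026Putative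
§3.4.3 (3.31)–(3.33), Rem. 3.6]
-/

noncomputable section

-- flat `Theorems/<Route><Decl>…` files of one crux share the namespace of the crux (tree convention)
set_option linter.dupNamespace false

open MeasureTheory Set Filter Topology Metric Function InnerProductSpace
open scoped RealInnerProductSpace NNReal ContDiff

namespace Summit.NavierStokesRegularity.NavierStokesRegularity.Theorems.PowerGaugeEulerLiouville.Kelvin

open Literature.Analysis Literature.Analysis.FluidPDE

variable {γ : ℝ} {V : EuclideanSpace ℝ (Fin 3) → EuclideanSpace ℝ (Fin 3)} {P : EuclideanSpace ℝ (Fin 3) → ℝ}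

/-! ### The Bernoulli function tends to `−∞` at infinity (`0 < γ < ½`) -/

/-- Quadratic upper bound: `ℋ(z) ≤ −γ(½−γ)‖z‖² + γM‖z‖ + (½M² + P₀)` when `‖V‖ ≤ M`, `P ≤ P₀`.
[cite: ConstantinIgnatovaVicol2026Putative, §3.4.3 eq. (3.30)] -/
theorem bernoulli_le_quadratic {M P₀ : ℝ} (hM : ∀ y, ‖V y‖ ≤ M) (hP : ∀ y, P y ≤ P₀) (hγ : 0 ≤ γ)
    (z : EuclideanSpace ℝ (Fin 3)) :
    selfSimilarBernoulli γ 0 V P z ≤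
      -(γ * (1 / 2 - γ)) * ‖z‖ ^ 2 + γ * M * ‖z‖ + (1 / 2 * M ^ 2 + P₀) := by
  rw [selfSimilarBernoulli_apply, sub_zero]
  have hM0 : 0 ≤ M := (norm_nonneg _).trans (hM 0)
  have h1 : ‖γ • z + V z‖ ≤ γ * ‖z‖ + M := by
    calc ‖γ • z + V z‖ ≤ ‖γ • z‖ + ‖V z‖ := norm_add_le _ _
      _ ≤ γ * ‖z‖ + M := by rw [norm_smul, Real.norm_of_nonneg hγ]; exact add_le_add le_rfl (hM z)
  have h2 : ‖γ • z + V z‖ ^ 2 ≤ (γ * ‖z‖ + M) ^ 2 := pow_le_pow_left₀ (norm_nonneg _) h1 2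
  have h3 := hP z
  nlinarith [norm_nonneg z]

/-- **Superlevel sets of `ℋ` are bounded** (`0 < γ < ½`, `‖V‖ ≤ M`, `P ≤ P₀`): if `ℋ(z) ≥ h₀` then
`‖z‖ ≤ max 1 ((γM + |½M² + P₀| + |h₀| + 1)/(γ(½−γ)))`. [cite: ConstantinIgnatovaVicol2026Putative, §3.4.3 (compact superlevel sets of `ℋ` for `γ < ½`)] -/
theorem norm_le_of_bernoulli_ge {M P₀ : ℝ} (hM : ∀ y, ‖V y‖ ≤ M) (hP : ∀ y, P y ≤ P₀) (hγ : 0 < γ)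
    (hγ2 : γ < 1 / 2) {h₀ : ℝ} {z : EuclideanSpace ℝ (Fin 3)} (hz : h₀ ≤ selfSimilarBernoulli γ 0 V P z) :
    ‖z‖ ≤ max 1 ((γ * M + |1 / 2 * M ^ 2 + P₀| + |h₀| + 1) / (γ * (1 / 2 - γ))) := by
  set a : ℝ := γ * (1 / 2 - γ) with ha
  have ha0 : 0 < a := mul_pos hγ (by linarith)
  set C₀ : ℝ := 1 / 2 * M ^ 2 + P₀ with hC₀
  have hM0 : 0 ≤ M := (norm_nonneg _).trans (hM 0)
  by_contra hcon
  rw [not_le, max_lt_iff] at hcon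
  obtain ⟨hz1, hzB⟩ := hcon
  have hq := bernoulli_le_quadratic hM hP hγ.le z
  rw [← ha, ← hC₀] at hq
  -- for `‖z‖ ≥ 1`: `ℋ(z) ≤ ‖z‖(−a‖z‖ + γM + |C₀|)`
  have hz0 : 0 < ‖z‖ := lt_trans one_pos hz1
  have h1 : -a * ‖z‖ ^ 2 + γ * M * ‖z‖ + C₀ ≤ ‖z‖ * (-a * ‖z‖ + γ * M + |C₀|) := by
    have : C₀ ≤ |C₀| * ‖z‖ := (le_abs_self C₀).trans (le_mul_of_one_le_right (abs_nonneg _) hz1.le)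
    nlinarith
  have h2 : -a * ‖z‖ + γ * M + |C₀| < -(|h₀| + 1) := by
    have := (div_lt_iff₀ ha0).1 hzB
    linarith
  have h3 : ‖z‖ * (-a * ‖z‖ + γ * M + |C₀|) < -(|h₀| + 1) := by
    calc ‖z‖ * (-a * ‖z‖ + γ * M + |C₀|) ≤ 1 * (-a * ‖z‖ + γ * M + |C₀|) := by
          have hneg : -a * ‖z‖ + γ * M + |C₀| ≤ 0 := by linarith [abs_nonneg h₀]
          nlinarith
      _ < -(|h₀| + 1) := by linarith
  have h4 : h₀ < h₀ := by
    calc h₀ ≤ selfSimilarBernoulli γ 0 V P z := hz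
      _ < -(|h₀| + 1) := by linarith
      _ < h₀ := by linarith [neg_abs_le h₀]
  exact lt_irrefl _ h4

/-! ### Backward trajectories are bounded and come to rest at the stagnation set -/

/-- The backward trajectory `t ↦ Φ_{−t} y` solves `Y' = −W(Y)`. [folklore] -/
theorem hasDerivAt_flow_neg (hV : ContDiff ℝ ∞ V) {K : ℝ} (hK : ∀ y, ‖fderiv ℝ V y‖ ≤ K)
    (y : EuclideanSpace ℝ (Fin 3)) (t : ℝ) :
    HasDerivAt (fun r => ODE.evolutionMap (fun _ : ℝ => selfSimilarTransport γ 0 V) 0 (-r) y)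
      ((-1 : ℝ) • selfSimilarTransport γ 0 V
        (ODE.evolutionMap (fun _ : ℝ => selfSimilarTransport γ 0 V) 0 (-t) y)) t := by
  have h1 := hasDerivAt_flow (γ := γ) hV hK (-t) y
  have h2 : HasDerivAt (fun r : ℝ => -r) (-1 : ℝ) t := hasDerivAt_neg t
  exact h1.scomp t h2

/-- **Backward trajectories are bounded** (`0 < γ < ½`, `‖V‖ ≤ M`, `‖DV‖ ≤ K`, `P ≤ P₀`): `ℋ(Φ_s y) ≥ ℋ(y)`
for `s ≤ 0`, hence `‖Φ_s y‖ ≤ B(ℋ(y))`. [cite: ConstantinIgnatovaVicol2026Putative, §3.4.3 eq. (3.31) (confinement of backward trajectories for `γ < ½`)] -/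
theorem norm_flow_le_of_nonpos (hV : ContDiff ℝ ∞ V) {K : ℝ} (hK : ∀ y, ‖fderiv ℝ V y‖ ≤ K)
    (hprof : IsSelfSimilarEulerProfile γ 0 V P) {M P₀ : ℝ} (hM : ∀ y, ‖V y‖ ≤ M) (hP : ∀ y, P y ≤ P₀)
    (hγ : 0 < γ) (hγ2 : γ < 1 / 2) (y : EuclideanSpace ℝ (Fin 3)) {s : ℝ} (hs : s ≤ 0) :
    ‖ODE.evolutionMap (fun _ : ℝ => selfSimilarTransport γ 0 V) 0 s y‖ ≤
      max 1 ((γ * M + |1 / 2 * M ^ 2 + P₀| + |selfSimilarBernoulli γ 0 V P y| + 1) / (γ * (1 / 2 - γ))) := by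
  refine norm_le_of_bernoulli_ge hM hP hγ hγ2 ?_
  -- `ℋ(Φ_s y) − ℋ(y) = −(2γ−1) ∫_0^{−s} |W|² ≥ 0`
  have hY := hasDerivAt_flow_neg (γ := γ) hV hK y
  have e := hprof.bernoulli_comp_sub_eq hY 0 (-s)
  simp only [neg_zero, neg_neg] at e
  have hflow0 : ODE.evolutionMap (fun _ : ℝ => selfSimilarTransport γ 0 V) 0 0 y = y := by
    rw [ODE.evolutionMap_self]
  rw [hflow0] at e
  have hint : 0 ≤ ∫ t in (0 : ℝ)..(-s), ‖selfSimilarTransport γ 0 V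
      (ODE.evolutionMap (fun _ : ℝ => selfSimilarTransport γ 0 V) 0 (-t) y)‖ ^ 2 :=
    intervalIntegral.integral_nonneg (by linarith) fun t _ => sq_nonneg _
  have hcoef : 0 ≤ -1 * (2 * γ - 1) := by nlinarith
  nlinarith

/-- **Every point of space flows backward into rest** (`0 < γ < ½`): `W(Φ_s y) → 0` as `s → −∞`, for
every `y`. [cite: ConstantinIgnatovaVicol2026Putative, §3.4.3 eq. (3.31)–(3.33), Rem. 3.6] -/
theorem tendsto_transport_flow_atBot (hV : ContDiff ℝ ∞ V) {K : ℝ} (hK : ∀ y, ‖fderiv ℝ V y‖ ≤ K)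
    (hprof : IsSelfSimilarEulerProfile γ 0 V P) {M P₀ : ℝ} (hM : ∀ y, ‖V y‖ ≤ M) (hP : ∀ y, P y ≤ P₀)
    (hγ : 0 < γ) (hγ2 : γ < 1 / 2) (y : EuclideanSpace ℝ (Fin 3)) :
    Tendsto (fun s => selfSimilarTransport γ 0 V
      (ODE.evolutionMap (fun _ : ℝ => selfSimilarTransport γ 0 V) 0 s y)) atBot (𝓝 0) := by
  have hY := hasDerivAt_flow_neg (γ := γ) hV hK y
  have hB : ∀ t : ℝ, 0 ≤ t → ‖ODE.evolutionMap (fun _ : ℝ => selfSimilarTransport γ 0 V) 0 (-t) y‖ ≤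
      max 1 ((γ * M + |1 / 2 * M ^ 2 + P₀| + |selfSimilarBernoulli γ 0 V P y| + 1) / (γ * (1 / 2 - γ))) :=
    fun t ht => norm_flow_le_of_nonpos hV hK hprof hM hP hγ hγ2 y (by linarith)
  have hlim := hprof.tendsto_transport_comp_of_bounded (ne_of_lt hγ2) (σ := -1) (by norm_num) hY hB
  have hcomp := hlim.comp tendsto_neg_atBot_atTop
  refine hcomp.congr fun s => ?_
  simp only [Function.comp_apply, neg_neg]

/-- **Every backward trajectory accumulates at a stagnation point** (`0 < γ < ½`): for every `y` there is
`z` in the nodal set `𝒩_W` (`W(z) = 0`) which is a cluster point of `Φ_{−t} y` as `t → ∞`; in particular the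
stagnation set of an in-window classical profile with bounded `V`, `DV` and `P` bounded above is non-empty and
its unstable set is all of `ℝ³`. [cite: ConstantinIgnatovaVicol2026Putative, §3.4.3 eq. (3.33), Rem. 3.6] -/
theorem exists_mem_nodalSet_mapClusterPt_atBot (hV : ContDiff ℝ ∞ V) {K : ℝ} (hK : ∀ y, ‖fderiv ℝ V y‖ ≤ K)
    (hprof : IsSelfSimilarEulerProfile γ 0 V P) {M P₀ : ℝ} (hM : ∀ y, ‖V y‖ ≤ M) (hP : ∀ y, P y ≤ P₀)
    (hγ : 0 < γ) (hγ2 : γ < 1 / 2) (y : EuclideanSpace ℝ (Fin 3)) :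
    ∃ z ∈ selfSimilarNodalSet γ 0 V,
      MapClusterPt z atTop (fun t => ODE.evolutionMap (fun _ : ℝ => selfSimilarTransport γ 0 V) 0 (-t) y) := by
  have hY := hasDerivAt_flow_neg (γ := γ) hV hK y
  have hB : ∀ t : ℝ, 0 ≤ t → ‖ODE.evolutionMap (fun _ : ℝ => selfSimilarTransport γ 0 V) 0 (-t) y‖ ≤
      max 1 ((γ * M + |1 / 2 * M ^ 2 + P₀| + |selfSimilarBernoulli γ 0 V P y| + 1) / (γ * (1 / 2 - γ))) :=
    fun t ht => norm_flow_le_of_nonpos hV hK hprof hM hP hγ hγ2 y (by linarith)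
  obtain ⟨z, hz, -, hcl⟩ :=
    hprof.exists_mem_nodalSet_mapClusterPt_of_bounded (ne_of_lt hγ2) (σ := -1) (by norm_num) hY hB
  exact ⟨z, hz, hcl⟩

/-- In particular **the stagnation set of an in-window classical profile is non-empty**.
[cite: ConstantinIgnatovaVicol2026Putative, §3.5 Def. 3.7 (the nodal set), Rem. 3.6] -/
theorem nodalSet_nonempty (hV : ContDiff ℝ ∞ V) {K : ℝ} (hK : ∀ y, ‖fderiv ℝ V y‖ ≤ K)
    (hprof : IsSelfSimilarEulerProfile γ 0 V P) {M P₀ : ℝ} (hM : ∀ y, ‖V y‖ ≤ M) (hP : ∀ y, P y ≤ P₀)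
    (hγ : 0 < γ) (hγ2 : γ < 1 / 2) : (selfSimilarNodalSet γ 0 V).Nonempty := by
  obtain ⟨z, hz, -⟩ := exists_mem_nodalSet_mapClusterPt_atBot hV hK hprof hM hP hγ hγ2 0
  exact ⟨z, hz⟩

end Summit.NavierStokesRegularity.NavierStokesRegularity.Theorems.PowerGaugeEulerLiouville.Kelvin

end
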